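import Literature.AlgebraicGeometry.Motives.FaltingsECEndomorphismsProofs
import Literature.AlgebraicGeometry.Motives.FaltingsECRankTwoProofs
import Literature.NumberTheory.EllipticCurves.FrobeniusEndomorphism
import HarnessLib

/-!
# Tate's theorem for elliptic curves over finite fields: the `End` form outside the central case

D-0014 keeps `Literature/` sorry-free by stating cited results as named facts `def X : Prop`.
This sibling file of `Literature.AlgebraicGeometry.Motives.FaltingsEC` concerns the named fact
`Literature.Hodge.mem_span_range_tateEndRingHom_iff_of_finite W ℓ` — Tate's theorem in `End` form for an
elliptic curve `E` over a finite field `k` with `q` elements and a prime `ℓ ≠ char k`: inside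
`End_{ℤ_ℓ}(T_ℓ E)`, the `ℤ_ℓ`-span `S = ℤ_ℓ · End_k(E)` of the image of `End_k(E)`
(`tateEndRingHom`) is exactly the set of `Γ_k`-equivariant endomorphisms (J. Tate, Invent. Math.
2 (1966), Main Theorem, for `A = B = E`; J. H. Silverman, *AEC*, 2nd ed., Isogeny Theorem
III.7.7(a)). Everything in this file is proved; the inputs that the tree states as named facts
enter as explicit hypotheses. Following the architecture of Tate's paper (cf. Waterhouse, *Abelian
varieties over finite fields*, Ann. Sci. ÉNS 2 (1969), Ch. 2, and Milne, *The Work of John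
Tate*, §4.3.1):

* **§1 (torsion-free cokernel of `ℤ_ℓ ⊗ End_k(E) → End(T_ℓ E)`).** The tree proves that `S` is
  `ℓ`-saturated in `End(T_ℓ E)` from *AEC* III.§4 and Cor. III.4.11
  (`Literature.AlgebraicGeometry.Motives.mem_span_range_tateEndRingHom_of_smul_mem`, `Literature.AlgebraicGeometry.Motives.mem_of_padicInt_smul_mem` of
  `FaltingsECEndomorphismsProofs`); hence the integral statement is equivalent to its
  `ℚ_ℓ`-form "every `Γ_k`-equivariant `g` has `ℓⁿ • g ∈ S` for some `n`" (Tate, §1, Lemma 1: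
  "(1) bijective ⟺ (2) bijective"): `mem_span_range_tateEndRingHom_iff_of_finite_of_rational`.
* **§2, the commutant of Frobenius.** Let `σ_q ∈ Γ_k` be the arithmetic Frobenius
  (`σ_q x = x ^ q` on `k̄`) and `π = φ_q ∈ End_k(E)` the `q`-power Frobenius endomorphism
  (the tree's `WeierstrassCurve.frobeniusIsogeny`, *AEC* Ex. III.4.6), so that
  `T_ℓ(π) = ρ_{E,ℓ}(σ_q)` (`WeierstrassCurve.tateModule_map_frobeniusIsogeny`). A `Γ_k`-equivariant
  `g` commutes with `T_ℓ(π)`. **If `σ_q` does not act on `T_ℓ E ≅ ℤ_ℓ²` as an `ℓ`-adic scalar**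
  (true for every ordinary `E` and for the supersingular ones with `π ∉ ℤ`), then the commutant
  of `T_ℓ(π)` in `End(V_ℓ E) = M₂(ℚ_ℓ)` is `ℚ_ℓ[T_ℓ(π)] = ℚ_ℓ ⊗ ℤ[π]` (Tate, end of §2: "`F_ℓ` is
  its own commutant"; Waterhouse, p. 527: "the action of `E_ℓ` on `V_ℓ A` is the only possible
  one"), so `ℓⁿ • g = a + b T_ℓ(π) ∈ S`: `exists_pow_smul_eq_of_commute_of_finrank_eq_two`
  (from the tree's `Literature.AlgebraicGeometry.Motives.FinTwo.exists_smul_eq_of_commute`, `exists_det_apply_ne_zero`, with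
  denominators `d = u ℓⁿ`), `exists_pow_smul_mem_span_range_tateEndRingHom_of_not_smul`, and with
  §1 **Tate's theorem in `End` form for such `E`, proved from *AEC* III.§4 and Cor. III.4.11
  alone**: `mem_span_range_tateEndRingHom_of_equivariant_of_not_smul`,
  `mem_span_range_tateEndRingHom_iff_of_not_smul`.
* **The central case** (`σ_q` acts on `T_ℓ E` as a scalar; then `π ∈ ℤ`, `q` is a square,
  `π = ±√q`, `E` is supersingular with all endomorphisms defined over `k` and
  `ℚ ⊗ End_k(E)` is the quaternion algebra ramified at `p, ∞`, so that the theorem amounts to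
  `rank_ℤ End_k(E) = 4`: Waterhouse, Ch. 2, Case 1, p. 528 and Thm. 4.1; Milne, §2.6) is the
  genuinely arithmetic part of Tate's theorem (his Proposition 1: finiteness of the `k`-forms
  `E / X_n`, compactness; Proposition 2), treated for the `Hom` form by the sibling files
  `FaltingsECTateProp1Proofs`, `FaltingsECRankTwoProofs`, `FaltingsECRankTwoLimitProofs`. Here it
  enters only as a hypothesis: `mem_span_range_tateEndRingHom_iff_of_finite_of_central` shows
  that the named fact follows from *AEC* III.§4, Cor. III.4.11 and the `ℚ_ℓ`-statement in the
  central case alone.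
* **Route through the `Hom` form.** `mem_span_range_tateEndRingHom_iff_of_finite_of_hom`: the named
  fact follows from the tree's `Hom`-form fact
  `Literature.Hodge.mem_span_range_tateModule_map_of_equivariant_of_finite W W ℓ` (Tate's Main Theorem
  for `A = B = E`), as an isogeny `E → E` over `k` lies in `End_k(E)`.

## References

* [Tate1966Endomorphisms] J. Tate, *Endomorphisms of abelian varieties over finite fields*,
  Invent. Math. 2 (1966), 134–144: §1 Lemma 1 (torsion-free cokernel of (1)), Main Theorem,
  §2 (commutant of `F_ℓ`), Thm. 2 (paper not held; statements taken from the sources below).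
* [SilvermanAEC2009] J. H. Silverman, *The Arithmetic of Elliptic Curves*, 2nd ed., GTM 106,
  Springer 2009: Thm. III.7.4 with its proof, Cor. III.4.11, Isogeny Theorem III.7.7(a),
  Example III.4.6 (Frobenius endomorphism), V.§2 (action of Frobenius on `T_ℓ(E)`).
* [Waterhouse1969] W. C. Waterhouse, *Abelian varieties over finite fields*, Ann. Sci. ÉNS (4)
  2 (1969), 521–560: Ch. 2 (pp. 526–528: `E = ℚ ⊗ End_k A` semisimple with centre `ℚ(π)`; at
  `ℓ ≠ p` "the action of `E_ℓ` on `V_ℓ A` is the only possible one"; Case 1, `π = ±√q ∈ ℚ`: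
  `g = 1`, `E` the quaternion algebra ramified at `p, ∞`) and Thm. 4.1 (p. 536).
* [Milne2013WorkOfTate] J. S. Milne, *The Work of John Tate*, in: The Abel Prize 2008–2012,
  Springer 2014, §2.6 (`2 dim A = [End⁰(A) : ℚ[π_A]]^{1/2} · [ℚ[π_A] : ℚ]`) and §4.3.1
  (arXiv:1210.7459, pp. 15, 22–23).

## Design choices

* `noncomputable section`, `open scoped Classical`, base field `K : Type u`, declarations in
  `namespace Literature.Hodge` next to the fact they serve; the commutant lemma is stated for any free
  `ℤ_ℓ`-module of rank `2` in a universe `v`.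
* The Frobenius is any `σ ∈ Γ_k` with `σ x = x ^ Nat.card k` on `k̄` (hypothesis `hσ`), exactly
  as in `Literature.NumberTheory.EllipticCurves.FrobeniusEndomorphism`, whose `frobeniusIsogeny`
  and `tateModule_map_frobeniusIsogeny` are reused; such a `σ` exists (e.g. the tree's
  `Literature.arithFrob k`) and is unique.
* The case distinction of §2 is the elementary condition `∃ c : ℤ_ℓ, ∀ x : T_ℓ E, σ • x = c • x`
  ("Frobenius acts on `T_ℓ E` as a scalar").
* No new definitions and no new named facts: the two elliptic-curve inputs of the saturation step
  are the tree's named facts `WeierstrassCurve.mem_geomEndRing_iff W` (*AEC* III.§4) and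
  `WeierstrassCurve.Isogeny.exists_eq_comp_nsmul_of_geomTorsion_le_ker W W` (*AEC* Cor. III.4.11),
  taken as hypotheses `hE`, `h411`; the `ℚ_ℓ`-statements enter spelled out.
-/

noncomputable section

open scoped Classical

universe u v

namespace Literature.AlgebraicGeometry.Motives

/-! ## The commutant of a non-scalar endomorphism of a free `ℤ_ℓ`-module of rank `2` -/

/-- **The commutant of a non-scalar endomorphism of a free `ℤ_ℓ`-module of rank `2`.** If `F` is
a `ℤ_ℓ`-linear endomorphism of a free `ℤ_ℓ`-module `M` of rank `2` which is not a scalar, then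
every endomorphism `g` commuting with `F` satisfies `ℓ ^ n • g = a • 1 + b • F` for some `n` and
`a, b ∈ ℤ_ℓ`; i.e. the commutant of `F` in `End_{ℚ_ℓ}(ℚ_ℓ ⊗ M) ≅ M₂(ℚ_ℓ)` is `ℚ_ℓ[F] = ℚ_ℓ + ℚ_ℓ F`.
Transported from the tree's `Literature.AlgebraicGeometry.Motives.FinTwo.exists_smul_eq_of_commute` (with the cyclic vector of
`Literature.AlgebraicGeometry.Motives.FinTwo.exists_det_apply_ne_zero`) on `ℤ_ℓ²` along a basis, writing the non-zero determinant
`d ∈ ℤ_ℓ` found there as a unit times `ℓ ^ n` (`PadicInt.unitCoeff_spec`). Tate, Invent. Math. 2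
(1966), end of §2 (the commutant of `F_ℓ = ℚ_ℓ ⊗ ℚ(π)`). [folklore] -/
theorem exists_pow_smul_eq_of_commute_of_finrank_eq_two {ℓ : ℕ} [Fact ℓ.Prime] {M : Type v}
    [AddCommGroup M] [Module ℤ_[ℓ] M] [Module.Free ℤ_[ℓ] M] [Module.Finite ℤ_[ℓ] M]
    (h2 : Module.finrank ℤ_[ℓ] M = 2) {F g : Module.End ℤ_[ℓ] M} (hc : g * F = F * g)
    (hF : ∀ c : ℤ_[ℓ], F ≠ c • (1 : Module.End ℤ_[ℓ] M)) :
    ∃ n : ℕ, ∃ a b : ℤ_[ℓ], (ℓ : ℤ_[ℓ]) ^ n • g = a • (1 : Module.End ℤ_[ℓ] M) + b • F := by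
  set e : Module.End ℤ_[ℓ] M ≃ₐ[ℤ_[ℓ]] Module.End ℤ_[ℓ] (Fin 2 → ℤ_[ℓ]) :=
    (Module.finBasisOfFinrankEq ℤ_[ℓ] M h2).equivFun.conjAlgEquiv ℤ_[ℓ] with he
  have hθ : ∀ c : ℤ_[ℓ], e F ≠ c • (1 : Module.End ℤ_[ℓ] (Fin 2 → ℤ_[ℓ])) := fun c hc' ↦
    hF c (e.injective (by rw [hc', map_smul, map_one]))
  have hcomm : e g * e F = e F * e g := by rw [← map_mul, ← map_mul, hc]
  obtain ⟨z, hD⟩ := FinTwo.exists_det_apply_ne_zero hθ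
  obtain ⟨α, β, hαβ⟩ := FinTwo.exists_smul_eq_of_commute z hD hcomm
  set d : ℤ_[ℓ] := z 0 * e F z 1 - z 1 * e F z 0 with hd
  set w := PadicInt.unitCoeff hD with hw
  have hu : ((w⁻¹ : ℤ_[ℓ]ˣ) : ℤ_[ℓ]) * d = (ℓ : ℤ_[ℓ]) ^ d.valuation :=
    (Units.inv_mul_eq_iff_eq_mul w).mpr (PadicInt.unitCoeff_spec hD)
  refine ⟨d.valuation, (w⁻¹ : ℤ_[ℓ]ˣ) * α, (w⁻¹ : ℤ_[ℓ]ˣ) * β, e.injective ?_⟩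
  rw [map_smul, ← hu, mul_smul, hαβ, map_add, map_smul, map_smul, map_one, smul_add, mul_smul,
    mul_smul]

open WeierstrassCurve

variable {K : Type u} [Field K] (W : WeierstrassCurve K) (ℓ : ℕ) [Fact ℓ.Prime]

/-! ## Tate §2 for elliptic curves: the commutant of Frobenius -/

/-- **Tate's theorem `⊗ ℚ_ℓ` for an elliptic curve whose Frobenius does not act on `T_ℓ E` as a
scalar** (proved): let `E` be an elliptic curve over a finite field `k` with `q` elements,
`ℓ ≠ char k` a prime, `σ_q ∈ Γ_k` the arithmetic Frobenius (`σ_q x = x ^ q` on `k̄`), and suppose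
`σ_q` does **not** act on `T_ℓ E ≅ ℤ_ℓ²` as multiplication by an `ℓ`-adic scalar (equivalently
`T_ℓ(π) ∉ ℤ_ℓ · 1` for the Frobenius endomorphism `π = φ_q`). Then every `ℤ_ℓ`-linear
`g : T_ℓ E → T_ℓ E` commuting with `Γ_k` satisfies `ℓ ^ n • g = a + b • ρ(σ_q)` for some `n` and
`a, b ∈ ℤ_ℓ` (`g` commutes with `ρ(σ_q)`, whose commutant is `ℚ_ℓ[ρ(σ_q)]`,
`exists_pow_smul_eq_of_commute_of_finrank_eq_two` with `rank_{ℤ_ℓ} T_ℓ E = 2`, *AEC* III.7.1(a),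
a theorem of the tree), and `ρ(σ_q) = T_ℓ(π)` lies in the image of `End_k(E)`
(`WeierstrassCurve.tateModule_map_frobeniusIsogeny`), so that `ℓ ^ n • g ∈ ℤ_ℓ · End_k(E)`. This
is the case of Tate's theorem (Invent. Math. 2 (1966), Main Theorem `⊗ ℚ_ℓ`; Silverman, *AEC*,
Thm. III.7.7(a)) in which `F_ℓ = ℚ_ℓ ⊗ ℚ(π)` is a maximal commutative subalgebra of `End(V_ℓ E)`
and hence its own commutant (Tate, end of §2; Waterhouse, Ann. Sci. ÉNS 2 (1969), Ch. 2,
pp. 526–527). [cite: Tate1966Endomorphisms, Main Theorem and §2] -/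
theorem exists_pow_smul_mem_span_range_tateEndRingHom_of_not_smul [Finite K] [W.IsElliptic]
    (hℓ : (ℓ : K) ≠ 0) {σ : Field.absoluteGaloisGroup K}
    (hσ : ∀ x : AlgebraicClosure K, σ • x = x ^ Nat.card K)
    (hπ : ¬ ∃ c : ℤ_[ℓ], ∀ x : W.tateModule ℓ, σ • x = c • x)
    {g : Module.End ℤ_[ℓ] (W.tateModule ℓ)}
    (hg : ∀ (τ : Field.absoluteGaloisGroup K) (x : W.tateModule ℓ), g (τ • x) = τ • g x) :
    ∃ n : ℕ, (ℓ : ℤ_[ℓ]) ^ n • g ∈ Submodule.span ℤ_[ℓ] (Set.range (tateEndRingHom W ℓ)) := by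
  haveI : Module.Free ℤ_[ℓ] (W.tateModule ℓ) := module_free_tateModule_holds W ℓ
  haveI : Module.Finite ℤ_[ℓ] (W.tateModule ℓ) := module_finite_tateModule_holds W ℓ
  have hcomm : g * galoisRepTate W ℓ σ = galoisRepTate W ℓ σ * g :=
    LinearMap.ext fun x ↦ by simpa using hg σ x
  have hF : ∀ c : ℤ_[ℓ], galoisRepTate W ℓ σ ≠ c • (1 : Module.End ℤ_[ℓ] (W.tateModule ℓ)) :=
    fun c hc ↦ hπ ⟨c, fun x ↦ by simpa using LinearMap.congr_fun hc x⟩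
  obtain ⟨n, a, b, hab⟩ := exists_pow_smul_eq_of_commute_of_finrank_eq_two
    (finrank_tateModule_eq_two_holds W ℓ hℓ) hcomm hF
  refine ⟨n, ?_⟩
  rw [hab]
  refine Submodule.add_mem _
    (Submodule.smul_mem _ a (Submodule.subset_span ⟨1, map_one _⟩))
    (Submodule.smul_mem _ b (Submodule.subset_span
      ⟨⟨((W.frobeniusIsogeny hσ).toAddMonoidHom : AddMonoid.End W.geomPoints),
        (W.frobeniusIsogeny hσ).toAddMonoidHom_mem_endRing⟩, ?_⟩))
  rw [tateEndRingHom_apply]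
  exact W.tateModule_map_frobeniusIsogeny hσ ℓ

/-- **Tate's theorem (`End` form) for an elliptic curve over a finite field whose Frobenius does
not act on `T_ℓ E` as a scalar, from *AEC* III.§4 and Cor. III.4.11** (proved): let `E / k`,
`ℓ ≠ char k`, `σ_q` be as in `exists_pow_smul_mem_span_range_tateEndRingHom_of_not_smul`
(`σ_q` not an `ℓ`-adic scalar on `T_ℓ E`), and grant the tree's named facts
`W.mem_geomEndRing_iff` (`hE`: an element of `End_{K̄}(E)` is `0` or algebraic, Silverman,
*AEC*, III.§4) and `Isogeny.exists_eq_comp_nsmul_of_geomTorsion_le_ker W W` (`h411`: an isogeny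
`E → E` over `k` killing `E[m]`, `m ≠ 0` in `k`, factors through `[m]`, *AEC* Cor. III.4.11).
Then every `Γ_k`-equivariant `g ∈ End_{ℤ_ℓ}(T_ℓ E)` lies in `ℤ_ℓ · End_k(E)`: by the previous
theorem `ℓ ^ n • g ∈ ℤ_ℓ · End_k(E)`, and `ℤ_ℓ · End_k(E)` is saturated in `End(T_ℓ E)` (the
cokernel of `ℤ_ℓ ⊗ End_k(E) → End(T_ℓ E)` is torsion-free; Tate, §1, Lemma 1; the tree's
`mem_span_range_tateEndRingHom_of_smul_mem`, which is the argument of the proof of *AEC*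
Thm. III.7.4). Tate, Invent. Math. 2 (1966), Main Theorem; Silverman, *AEC*, Thm. III.7.7(a).
[cite: Tate1966Endomorphisms, Main Theorem] -/
theorem mem_span_range_tateEndRingHom_of_equivariant_of_not_smul [Finite K] [W.IsElliptic]
    (hℓ : (ℓ : K) ≠ 0) (hE : W.mem_geomEndRing_iff)
    (h411 : Isogeny.exists_eq_comp_nsmul_of_geomTorsion_le_ker W W)
    {σ : Field.absoluteGaloisGroup K} (hσ : ∀ x : AlgebraicClosure K, σ • x = x ^ Nat.card K)
    (hπ : ¬ ∃ c : ℤ_[ℓ], ∀ x : W.tateModule ℓ, σ • x = c • x)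
    {g : Module.End ℤ_[ℓ] (W.tateModule ℓ)}
    (hg : ∀ (τ : Field.absoluteGaloisGroup K) (x : W.tateModule ℓ), g (τ • x) = τ • g x) :
    g ∈ Submodule.span ℤ_[ℓ] (Set.range (tateEndRingHom W ℓ)) := by
  obtain ⟨n, hn⟩ := exists_pow_smul_mem_span_range_tateEndRingHom_of_not_smul W ℓ hℓ hσ hπ hg
  have hℓ0 : (ℓ : ℤ_[ℓ]) ^ n ≠ 0 := pow_ne_zero _ (Nat.cast_ne_zero.mpr (Fact.out : ℓ.Prime).ne_zero)
  exact mem_of_padicInt_smul_mem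
    (fun g' hg' ↦ mem_span_range_tateEndRingHom_of_smul_mem W ℓ
      (fun _ hψ ↦ eq_zero_or_exists_isogeny_of_mem_endRing W hE hψ) (fun χ hχ ↦ h411 hℓ χ hχ) hg')
    hℓ0 hn

/-- **Tate's theorem, `End` form, in the non-central case** (proved from *AEC* III.§4 and
Cor. III.4.11, hypotheses `hE`, `h411`): for `E` elliptic over a finite field `k`, `ℓ ≠ char k`,
and the Frobenius `σ_q` not an `ℓ`-adic scalar on `T_ℓ E`, a `ℤ_ℓ`-linear endomorphism of
`T_ℓ E` lies in `ℤ_ℓ · End_k(E)` if and only if it commutes with `Γ_k` — the conclusion of the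
named fact `mem_span_range_tateEndRingHom_iff_of_finite W ℓ` for such curves (all ordinary ones,
and the supersingular ones with `π ∉ ℤ`). The forward implication is the elementary
`smul_of_mem_span_range_tateEndRingHom`. Tate, Invent. Math. 2 (1966), Main Theorem; Silverman,
*AEC*, Thm. III.7.7(a). [cite: Tate1966Endomorphisms, Main Theorem] -/
theorem mem_span_range_tateEndRingHom_iff_of_not_smul [Finite K] [W.IsElliptic]
    (hℓ : (ℓ : K) ≠ 0) (hE : W.mem_geomEndRing_iff)
    (h411 : Isogeny.exists_eq_comp_nsmul_of_geomTorsion_le_ker W W)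
    {σ : Field.absoluteGaloisGroup K} (hσ : ∀ x : AlgebraicClosure K, σ • x = x ^ Nat.card K)
    (hπ : ¬ ∃ c : ℤ_[ℓ], ∀ x : W.tateModule ℓ, σ • x = c • x)
    (g : Module.End ℤ_[ℓ] (W.tateModule ℓ)) :
    g ∈ Submodule.span ℤ_[ℓ] (Set.range (tateEndRingHom W ℓ)) ↔
      ∀ (τ : Field.absoluteGaloisGroup K) (x : W.tateModule ℓ), g (τ • x) = τ • g x :=
  ⟨fun hg τ x ↦ smul_of_mem_span_range_tateEndRingHom W ℓ hg τ x,
    fun hg ↦ mem_span_range_tateEndRingHom_of_equivariant_of_not_smul W ℓ hℓ hE h411 hσ hπ hg⟩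

/-! ## Assemblies of the named fact -/

/-- **Tate §1, Lemma 1 for the `End` form: the integral statement from the `ℚ_ℓ`-statement.**
The named fact `mem_span_range_tateEndRingHom_iff_of_finite W ℓ` follows from *AEC* III.§4 (`hE`),
Cor. III.4.11 (`h411`) — through the saturation of `ℤ_ℓ · End_k(E)` in `End(T_ℓ E)` proved in the
tree — and the `ℚ_ℓ`-form of Tate's Main Theorem for `E` (`hT`: every `Γ_k`-equivariant
`g ∈ End_{ℤ_ℓ}(T_ℓ E)` has `ℓ ^ n • g ∈ ℤ_ℓ · End_k(E)` for some `n`, i.e.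
`ℚ_ℓ ⊗ End_k(E) → End_{Γ_k}(V_ℓ E)` is onto). Tate, Invent. Math. 2 (1966), §1 Lemma 1 and
Main Theorem; Silverman, *AEC*, Thm. III.7.7(a). [cite: Tate1966Endomorphisms, §1 Lemma 1 and Main Theorem] -/
theorem mem_span_range_tateEndRingHom_iff_of_finite_of_rational (hE : W.mem_geomEndRing_iff)
    (h411 : Isogeny.exists_eq_comp_nsmul_of_geomTorsion_le_ker W W)
    (hT : ∀ [Finite K] [W.IsElliptic], (ℓ : K) ≠ 0 → ∀ g : Module.End ℤ_[ℓ] (W.tateModule ℓ),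
      (∀ (τ : Field.absoluteGaloisGroup K) (x : W.tateModule ℓ), g (τ • x) = τ • g x) →
        ∃ n : ℕ, (ℓ : ℤ_[ℓ]) ^ n • g ∈ Submodule.span ℤ_[ℓ] (Set.range (tateEndRingHom W ℓ))) :
    mem_span_range_tateEndRingHom_iff_of_finite W ℓ := by
  intro _ _ hℓ g
  refine ⟨fun hg τ x ↦ smul_of_mem_span_range_tateEndRingHom W ℓ hg τ x, fun hg ↦ ?_⟩
  obtain ⟨n, hn⟩ := hT hℓ g hg
  have hℓ0 : (ℓ : ℤ_[ℓ]) ^ n ≠ 0 := pow_ne_zero _ (Nat.cast_ne_zero.mpr (Fact.out : ℓ.Prime).ne_zero)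
  exact mem_of_padicInt_smul_mem
    (fun g' hg' ↦ mem_span_range_tateEndRingHom_of_smul_mem W ℓ
      (fun _ hψ ↦ eq_zero_or_exists_isogeny_of_mem_endRing W hE hψ) (fun χ hχ ↦ h411 hℓ χ hχ) hg')
    hℓ0 hn

/-- **The named fact from the central case alone.** `mem_span_range_tateEndRingHom_iff_of_finite
W ℓ` follows from *AEC* III.§4 (`hE`), Cor. III.4.11 (`h411`) and the `ℚ_ℓ`-form of Tate's
theorem in the single remaining case (`hC`): for the arithmetic Frobenius `σ_q` acting on
`T_ℓ E` as an `ℓ`-adic scalar — `E` supersingular with `π = ±√q ∈ ℤ`, where the statement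
amounts to `rank_ℤ End_k(E) = 4` (Waterhouse, Ann. Sci. ÉNS 2 (1969), Ch. 2, Case 1, p. 528,
and Thm. 4.1; Milne, *The Work of John Tate*, §2.6) and is the content of Tate's Propositions 1–2
(§2) — every `Γ_k`-equivariant `g` has `ℓ ^ n • g ∈ ℤ_ℓ · End_k(E)`. The other case is
`exists_pow_smul_mem_span_range_tateEndRingHom_of_not_smul`; a Frobenius `σ_q ∈ Γ_k` exists by
the tree's `Literature.AlgebraicGeometry.Motives.arithFrob` (not imported: any `σ` with `σ x = x ^ q` is produced here from
Mathlib's `FiniteField.frobeniusAlgEquivOfAlgebraic`). Tate, Invent. Math. 2 (1966), Main Theorem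
and §2; Silverman, *AEC*, Thm. III.7.7(a). [cite: Tate1966Endomorphisms, Main Theorem and §2] -/
theorem mem_span_range_tateEndRingHom_iff_of_finite_of_central (hE : W.mem_geomEndRing_iff)
    (h411 : Isogeny.exists_eq_comp_nsmul_of_geomTorsion_le_ker W W)
    (hC : ∀ [Finite K] [W.IsElliptic], (ℓ : K) ≠ 0 → ∀ σ : Field.absoluteGaloisGroup K,
      (∀ x : AlgebraicClosure K, σ • x = x ^ Nat.card K) →
      (∃ c : ℤ_[ℓ], ∀ x : W.tateModule ℓ, σ • x = c • x) →
        ∀ g : Module.End ℤ_[ℓ] (W.tateModule ℓ),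
          (∀ (τ : Field.absoluteGaloisGroup K) (x : W.tateModule ℓ), g (τ • x) = τ • g x) →
            ∃ n : ℕ, (ℓ : ℤ_[ℓ]) ^ n • g ∈ Submodule.span ℤ_[ℓ] (Set.range (tateEndRingHom W ℓ))) :
    mem_span_range_tateEndRingHom_iff_of_finite W ℓ := by
  refine mem_span_range_tateEndRingHom_iff_of_finite_of_rational W ℓ hE h411 fun hℓ g hg ↦ ?_
  -- a Frobenius element of `Γ_k`
  letI : Fintype K := Fintype.ofFinite K
  set σ : Field.absoluteGaloisGroup K :=
    FiniteField.frobeniusAlgEquivOfAlgebraic K (AlgebraicClosure K) with hσdef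
  have hσ : ∀ x : AlgebraicClosure K, σ • x = x ^ Nat.card K := fun x ↦ by
    rw [Nat.card_eq_fintype_card]
    rfl
  by_cases hπ : ∃ c : ℤ_[ℓ], ∀ x : W.tateModule ℓ, σ • x = c • x
  · exact hC hℓ σ hσ hπ g hg
  · exact exists_pow_smul_mem_span_range_tateEndRingHom_of_not_smul W ℓ hℓ hσ hπ hg

/-- **The `End` form from the `Hom` form** (Tate's Main Theorem for `A = B = E`): the named fact
`mem_span_range_tateEndRingHom_iff_of_finite W ℓ` follows from the tree's named fact
`mem_span_range_tateModule_map_of_equivariant_of_finite W W ℓ` (over a finite field, for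
`ℓ ≠ char k`, every `Γ_k`-equivariant `ℤ_ℓ`-linear map `T_ℓ E → T_ℓ E` is in the `ℤ_ℓ`-span of
the `T_ℓ φ`, `φ : E → E` an isogeny over `k`), because an isogeny `E → E` over `k` is an element of
`End_k(E)` (`span_range_tateModule_map_le_span_range_tateEndRingHom`) and the forward implication
is `smul_of_mem_span_range_tateEndRingHom`. Tate, Invent. Math. 2 (1966), Main Theorem;
Silverman, *AEC*, Thm. III.7.7(a). [cite: Tate1966Endomorphisms, Main Theorem] -/
theorem mem_span_range_tateEndRingHom_iff_of_finite_of_hom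
    (h : mem_span_range_tateModule_map_of_equivariant_of_finite W W ℓ) :
    mem_span_range_tateEndRingHom_iff_of_finite W ℓ := by
  intro _ _ hℓ g
  exact ⟨fun hg τ x ↦ smul_of_mem_span_range_tateEndRingHom W ℓ hg τ x,
    fun hg ↦ span_range_tateModule_map_le_span_range_tateEndRingHom W ℓ (h hℓ g hg)⟩

end Literature.AlgebraicGeometry.Motives
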